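import Literature.Geometry.Kaehler.ManifoldForms
import HarnessLib

/-!
# Differential forms on manifolds: chart-wise smoothness versus bundled smoothness

Trunk: Kähler / Hodge (`Literature.Geometry.Kaehler.ManifoldForms`).

`Literature.Geometry.Kaehler.ManifoldForms` defines smoothness of a form `α` on a real manifold
chart-wise (`IsSmoothForm α`: at every `x₀` the chart representative `α.inChart x₀` is `C^∞`
within `range I` at the centre of the extended chart at `x₀`) and records, as the *named fact*
`Literature.Geometry.Kaehler.isSmoothForm_iff_contMDiff_totalSpace`, that this is equivalent to
smoothness of the section `x ↦ ⟨x, α x⟩` of Mathlib's vector bundle of continuous alternating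
maps on the tangent bundle (`Bundle.ContinuousAlternatingMap.instVectorBundle`, the bundled
`ContMDiff` spelling). This file proves that fact (`isSmoothForm_iff_contMDiff_totalSpace_holds`).

This is Warner's definition of a differential `k`-form as a `C^∞` lifting `M → Λ_k^*(M)`
(Def. 2.15) together with its coordinate criterion (Remark 2.16(2): a lifting is a differential
`k`-form iff its expression in each coordinate system is `C^∞`). In Mathlib's language: by
`Bundle.contMDiffAt_section` the section is `C^∞` at `x₀` iff its coordinate expression in the
trivialization at `x₀` is; read in the extended chart at `x₀` (`contMDiffAt_iff_source`), that
coordinate expression *is* the chart representative `α.inChart x₀` on the whole chart target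
(`MForm.inChart_eq_trivializationAt`), because the inverse tangent trivialization at `x₀` is the
derivative within `range I` of the inverse extended chart (`TangentBundle.symmL_trivializationAt`)
and the coefficient bundle `Bundle.Trivial M F` is trivialized by the identity.

## Main results

* `Literature.Geometry.Kaehler.MForm.inChart_eq_trivializationAt`: on the chart target,
  `α.inChart x₀ y` is the fibre component of the bundle trivialization at `x₀` applied to
  `⟨(extChartAt I x₀).symm y, α _⟩`.
* `Literature.Geometry.Kaehler.isSmoothForm_iff_contMDiff_totalSpace_holds`: the discharge.

## References

* F. W. Warner, *Foundations of Differentiable Manifolds and Lie Groups*, GTM 94 (1983),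
  Def. 2.15, Remark 2.16(2), 2.17 (pp. 62–63). [WarnerGTM94]
-/

noncomputable section

open scoped Manifold ContDiff Topology
open Bundle Set

namespace Literature.Geometry.Kaehler

variable {E : Type*} [NormedAddCommGroup E] [NormedSpace ℝ E]
  {H : Type*} [TopologicalSpace H] {I : ModelWithCorners ℝ E H}
  {M : Type*} [TopologicalSpace M] [ChartedSpace H M]
  {F : Type*} [NormedAddCommGroup F] [NormedSpace ℝ F] {k : ℕ}

/-- **The chart representative is the coordinate expression of the section in the bundle
chart.** On the target of the extended chart at `x₀`, the representative `α.inChart x₀` of a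
form `α` coincides with the fibre component of the trivialization at `x₀` of Mathlib's bundle
of continuous alternating maps `x ↦ TangentSpace I x [⋀^Fin k]→L[ℝ] F` applied to the section
`x ↦ ⟨x, α x⟩`, read through `(extChartAt I x₀).symm`: both pull `α` back along
`(trivializationAt E (TangentSpace I) x₀).symmL ℝ _`, the derivative within `range I` of
`(extChartAt I x₀).symm` (`TangentBundle.symmL_trivializationAt`), the values being
trivialized by the identity of `F` (`Bundle.Trivial.continuousLinearMapAt_trivialization`).
Warner (1983), 2.16(2) (coordinate expression of a form). [cite: WarnerGTM94, 2.16(2)] -/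
theorem MForm.inChart_eq_trivializationAt [IsManifold I ∞ M] (α : MForm I M F k) {x₀ : M}
    {y : E} (hy : y ∈ (extChartAt I x₀).target) :
    α.inChart x₀ y =
      (trivializationAt (E [⋀^Fin k]→L[ℝ] F) (fun x ↦ TangentSpace I x [⋀^Fin k]→L[ℝ] F) x₀
        ⟨(extChartAt I x₀).symm y, α ((extChartAt I x₀).symm y)⟩).2 := by
  have hx : (extChartAt I x₀).symm y ∈ (chartAt H x₀).source := by
    rw [← extChartAt_source I]
    exact (extChartAt I x₀).map_target hy
  -- the derivative of the inverse chart at `y` is the inverse tangent trivialization at `x₀`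
  -- over `(extChartAt I x₀).symm y`
  have hD : mfderivWithin 𝓘(ℝ, E) I (extChartAt I x₀).symm (range I) y =
      (trivializationAt E (TangentSpace I) x₀).symmL ℝ ((extChartAt I x₀).symm y) := by
    rw [TangentBundle.symmL_trivializationAt hx, (extChartAt I x₀).right_inv hy]
  rw [FiberBundle.trivializationAt_continuousAlternatingMap_apply]
  ext v
  simp only [MForm.inChart_apply, ContinuousAlternatingMap.inCoordinates,
    ContinuousLinearMap.compContinuousAlternatingMap_coe, Function.comp_apply,
    ContinuousAlternatingMap.compContinuousLinearMap_apply,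
    Bundle.Trivial.fiberBundle_trivializationAt',
    Bundle.Trivial.continuousLinearMapAt_trivialization, ContinuousLinearMap.coe_id', id_eq, hD,
    Function.comp_def]
  rfl

variable (I M F) in
/-- **Discharge of the named fact
`Literature.Geometry.Kaehler.isSmoothForm_iff_contMDiff_totalSpace`.** A form `α` on a `C^∞`
manifold is chart-wise smooth (`IsSmoothForm`: for every `x₀`, the representative
`α.inChart x₀` is `C^∞` within `range I` at `extChartAt I x₀ x₀`) iff the section
`x ↦ ⟨x, α x⟩` of Mathlib's vector bundle of continuous alternating maps on the tangent bundle
is `C^∞` (`ContMDiff I (I.prod 𝓘(ℝ, E [⋀^Fin k]→L[ℝ] F)) ∞`). This is Warner's definition of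
a differential form as a `C^∞` lifting into `Λ_k^*(M)` (Def. 2.15) together with its
coordinate criterion (Remark 2.16(2)). Proof, pointwise in `x₀`: `Bundle.contMDiffAt_section`
and `contMDiffAt_iff_source` turn bundled smoothness at `x₀` into `C^∞`-regularity within
`range I` at `extChartAt I x₀ x₀` of the coordinate expression of the section read through
`(extChartAt I x₀).symm`, which agrees with `α.inChart x₀` on the chart target
(`MForm.inChart_eq_trivializationAt`), a neighbourhood of the centre within `range I`
(`extChartAt_target_mem_nhdsWithin`). [cite: WarnerGTM94, Def. 2.15 and 2.16(2)] -/
theorem isSmoothForm_iff_contMDiff_totalSpace_holds :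
    isSmoothForm_iff_contMDiff_totalSpace I M F := by
  intro _ k α
  refine forall_congr' fun x₀ ↦ ?_
  rw [Bundle.contMDiffAt_section, contMDiffAt_iff_source,
    contMDiffWithinAt_iff_contDiffWithinAt]
  have hev : α.inChart x₀ =ᶠ[𝓝[range I] (extChartAt I x₀ x₀)]
      ((fun x ↦ (trivializationAt (E [⋀^Fin k]→L[ℝ] F)
        (fun x ↦ TangentSpace I x [⋀^Fin k]→L[ℝ] F) x₀ ⟨x, α x⟩).2) ∘ (extChartAt I x₀).symm) :=
    Filter.eventuallyEq_of_mem (extChartAt_target_mem_nhdsWithin x₀)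
      fun y hy ↦ α.inChart_eq_trivializationAt hy
  exact hev.congr_contDiffWithinAt (α.inChart_eq_trivializationAt (mem_extChartAt_target x₀))

end Literature.Geometry.Kaehler
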